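import Summits.RiemannHypothesis.RiemannHypothesis.Theorems.Splittings.LinearRayOnePointEvalCells
import Summits.RiemannHypothesis.RiemannHypothesis.Theorems.Splittings.LinearRayOnePoint
import Summits.RiemannHypothesis.RiemannHypothesis.Theorems.UniversalFactorMediumUEval
import Summits.RiemannHypothesis.RiemannHypothesis.Theorems.UniversalFactorMediumKernelNoGoStubPhiIoiTail

/-!
# Soundness of the u-side evaluator of `H_0′`, II: decomposition, tails, error constants, `mem_evalH0D` (cell rh-split, C15 / S-dbn-1)

Soundness, part II: `H0D_decomp` (`∫₀^∞ = Σ_c ∫_cell + ∫_U^∞`), the u-weighted kernel tail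
`∫_U^∞ Φ(u) u du ≤ 50 e^{10U − πe^{4U}}/(4πe^{4U} − 10)` (`phiD_pointwise`, `integral_phiD_Ioi_le`, via `u ≤ e^u`
and the tangent bound of `UniversalFactor.phiIoiTail_pointwise`), `uTailD_error`, the computable bound `le_uTailD`,
`derivErr_sound` (the two error constants of `derivErr`), and the main theorem
**`mem_evalH0D`: `Re H_0′(xn/xd) ∈ evalH0D C xn xd` for a valid context** (the real-integral identity
`Re H_0′(s) = −∫₀^∞ Φ(u) u sin(su) du` is `LinearRayOnePoint.re_deriv_deBruijnH_zero_ofReal`, from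
`XiMoments.iteratedDeriv_deBruijnH_zero`).
HONEST LABEL: machinery refuting an RH-STRENGTHENING conjunct (the linear-factor ray of
`Literature/Barriers/RiemannHypothesis/NewmanConjecture.lean`); RH-free; nothing here bears on the truth of RH.
Provenance: rh-splitx-eng-5 g3 (cell rh-split, D-0116 arm; C15 / S-dbn-1 filler → kernel), monolith
`HOME/rh-splitx-eng-5/ray/LinearRayOnePointMono.lean`.
-/

set_option linter.dupNamespace false

noncomputable section

namespace Summit.RiemannHypothesis.RiemannHypothesis.Theorems.Splittings.LinearRayOnePoint

open MeasureTheory Set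
open Literature.NumberTheory.LFunctions
open Literature.Analysis.ValidatedNumerics Literature.Analysis.ValidatedNumerics.NumericsMP
open Summit.RiemannHypothesis.RiemannHypothesis.Theorems

/-! ## The global decomposition and the u-tail of the derivative integrand -/

/-- `∫₀^∞ Φ u sin = Σ_{c<Cu} ∫_{cell c} + ∫_{U}^∞`, `U = 2 Cu ρ`. [folklore] -/
theorem H0D_decomp (x' : ℝ) {ρ : ℝ} (hρ : 0 ≤ ρ) (Cu : ℕ) :
    (∫ u in Ioi (0:ℝ), deBruijnPhi u * u * Real.sin (x' * u)) =
      ∑ c ∈ Finset.range Cu, (∫ u in (2 * c * ρ)..(2 * (c + 1) * ρ), deBruijnPhi u * u * Real.sin (x' * u)) +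
        ∫ u in Ioi (2 * Cu * ρ), deBruijnPhi u * u * Real.sin (x' * u) := by
  have hint := integrableOn_phi_mul_id_mul_sin x'
  have hU : (0:ℝ) ≤ 2 * Cu * ρ := by positivity
  have hsum := intervalIntegral.sum_integral_adjacent_intervals (f := fun u => deBruijnPhi u * u * Real.sin (x' * u))
    (μ := volume) (a := fun k : ℕ => 2 * (k : ℝ) * ρ) (n := Cu) ?_
  · simp only [Nat.cast_zero, mul_zero, zero_mul] at hsum
    have hsum' : ∑ c ∈ Finset.range Cu, (∫ u in (2 * c * ρ)..(2 * (c + 1) * ρ), deBruijnPhi u * u * Real.sin (x' * u)) =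
        ∫ u in (0:ℝ)..(2 * Cu * ρ), deBruijnPhi u * u * Real.sin (x' * u) := by
      rw [← hsum]
      refine Finset.sum_congr rfl fun c _ => ?_
      push_cast; rfl
    rw [hsum', intervalIntegral.integral_interval_add_Ioi hint (hint.mono_set (Ioi_subset_Ioi hU))]
  · intro k _
    refine ((continuousOn_phi_mul_id_mul_sin x').mono ?_).intervalIntegrable
    have hk : (0:ℝ) ≤ 2 * k * ρ := by positivity
    have hk1 : 2 * (k : ℝ) * ρ ≤ 2 * ((k + 1 : ℕ) : ℝ) * ρ := by push_cast; nlinarith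
    rw [uIcc_of_le hk1]
    exact fun u hu => le_trans hk hu.1

/-- Pointwise decay of the u-weighted kernel past `U ≥ 0`: for `u ≥ U`,
`Φ(u) u ≤ 50 e^{10U − π e^{4U}} e^{kU} e^{−ku}` with `k = 4π e^{4U} − 10` (`u ≤ e^u` and the
tangent bound of `UniversalFactor.phiIoiTail_pointwise`). [folklore] -/
theorem phiD_pointwise {U u : ℝ} (hU : 0 ≤ U) (hUu : U ≤ u) :
    deBruijnPhi u * u ≤ 50 * Real.exp (10 * U - Real.pi * Real.exp (4 * U)) *
      Real.exp ((4 * Real.pi * Real.exp (4 * U) - 10) * U) *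
      Real.exp (-(4 * Real.pi * Real.exp (4 * U) - 10) * u) := by
  have hu0 : 0 ≤ u := hU.trans hUu
  set E : ℝ := Real.exp (4 * U) with hE
  have hE0 : 0 ≤ E := (Real.exp_pos _).le
  have hΦ0 : 0 ≤ deBruijnPhi u := (deBruijnPhi_pos_of_nonneg hu0).le
  have h1 : deBruijnPhi u ≤ 50 * Real.exp (9 * u - Real.pi * Real.exp (4 * u)) := by
    have h := abs_deBruijnPhi_le hu0
    rw [abs_of_pos (deBruijnPhi_pos_of_nonneg hu0)] at h
    refine h.trans ?_
    gcongr
    exact UniversalFactor.phiIoiTail_tsum_majorant_le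
  have hu1 : u ≤ Real.exp u := by linarith [Real.add_one_le_exp u]
  have h1' : deBruijnPhi u * u ≤ 50 * Real.exp (10 * u - Real.pi * Real.exp (4 * u)) := by
    calc deBruijnPhi u * u ≤ 50 * Real.exp (9 * u - Real.pi * Real.exp (4 * u)) * Real.exp u :=
          mul_le_mul h1 hu1 hu0 (by positivity)
      _ = 50 * Real.exp (10 * u - Real.pi * Real.exp (4 * u)) := by
          rw [mul_assoc, ← Real.exp_add]; ring_nf
  have hexp : E * (4 * (u - U) + 1) ≤ Real.exp (4 * u) := by
    have h := Real.add_one_le_exp (4 * (u - U))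
    have heq : Real.exp (4 * u) = E * Real.exp (4 * (u - U)) := by
      rw [hE, ← Real.exp_add]; ring_nf
    rw [heq]
    gcongr
  have h2 : 10 * u - Real.pi * Real.exp (4 * u) ≤
      (10 * U - Real.pi * E) + (4 * Real.pi * E - 10) * U + (-(4 * Real.pi * E - 10) * u) := by
    nlinarith [Real.pi_pos, hexp, mul_le_mul_of_nonneg_left hexp Real.pi_pos.le]
  calc deBruijnPhi u * u ≤ 50 * Real.exp (10 * u - Real.pi * Real.exp (4 * u)) := h1'
    _ ≤ 50 * Real.exp ((10 * U - Real.pi * E) + (4 * Real.pi * E - 10) * U +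
          (-(4 * Real.pi * E - 10) * u)) := by gcongr
    _ = 50 * Real.exp (10 * U - Real.pi * E) * Real.exp ((4 * Real.pi * E - 10) * U) *
          Real.exp (-(4 * Real.pi * E - 10) * u) := by
        rw [Real.exp_add, Real.exp_add]; ring

/-- The u-weighted tail: `∫_U^∞ Φ(u) u du ≤ 50 e^{10U − π e^{4U}} / (4π e^{4U} − 10)` (`U ≥ 0`). [folklore] -/
theorem integral_phiD_Ioi_le {U : ℝ} (hU : 0 ≤ U) :
    ∫ u in Ioi U, deBruijnPhi u * u ≤
      50 * Real.exp (10 * U - Real.pi * Real.exp (4 * U)) / (4 * Real.pi * Real.exp (4 * U) - 10) := by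
  have hpt : ∀ u ∈ Ioi U, deBruijnPhi u * u ≤ 50 * Real.exp (10 * U - Real.pi * Real.exp (4 * U)) *
      Real.exp ((4 * Real.pi * Real.exp (4 * U) - 10) * U) *
      Real.exp (-(4 * Real.pi * Real.exp (4 * U) - 10) * u) :=
    fun u hu ↦ phiD_pointwise hU (le_of_lt hu)
  set E : ℝ := Real.exp (4 * U) with hE
  set k : ℝ := 4 * Real.pi * E - 10 with hk
  set C : ℝ := 50 * Real.exp (10 * U - Real.pi * E) with hC
  have hE1 : 1 ≤ E := Real.one_le_exp (by linarith)
  have hkpos : 0 < k := by nlinarith [Real.pi_gt_three]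
  have hint1 : IntegrableOn (fun u : ℝ => deBruijnPhi u * u) (Ioi U) := by
    have := (integrableOn_deBruijnPhi_mul_pow 1).mono_set (Ioi_subset_Ioi hU)
    exact this.congr_fun (fun u _ => by simp) measurableSet_Ioi
  have hint2 : IntegrableOn (fun u : ℝ ↦ C * Real.exp (k * U) * Real.exp (-k * u)) (Ioi U) :=
    (integrableOn_exp_mul_Ioi (by linarith : -k < 0) U).const_mul _
  have hee : Real.exp (k * U) * Real.exp (-k * U) = 1 := by
    rw [← Real.exp_add, neg_mul, add_neg_cancel, Real.exp_zero]
  calc ∫ u in Ioi U, deBruijnPhi u * u ≤ ∫ u in Ioi U, C * Real.exp (k * U) * Real.exp (-k * u) :=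
        setIntegral_mono_on hint1 hint2 measurableSet_Ioi hpt
    _ = C * Real.exp (k * U) * (-Real.exp (-k * U) / (-k)) := by
        rw [integral_const_mul, integral_exp_mul_Ioi (by linarith) U]
    _ = C * (Real.exp (k * U) * Real.exp (-k * U)) / k := by rw [neg_div_neg_eq]; ring
    _ = C / k := by rw [hee, mul_one]

/-- **u-tail of the derivative integrand**: `|∫_U^∞ Φ(u) u sin(x'u) du| ≤ 50 e^{10U − πe^{4U}}/(4πe^{4U} − 10)`. [folklore] -/
theorem uTailD_error (x' : ℝ) {U : ℝ} (hU : 0 ≤ U) :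
    |∫ u in Ioi U, deBruijnPhi u * u * Real.sin (x' * u)| ≤
      50 * Real.exp (10 * U - Real.pi * Real.exp (4 * U)) / (4 * Real.pi * Real.exp (4 * U) - 10) := by
  refine le_trans ?_ (integral_phiD_Ioi_le hU)
  have hint : IntegrableOn (fun u : ℝ => deBruijnPhi u * u) (Ioi U) := by
    have := (integrableOn_deBruijnPhi_mul_pow 1).mono_set (Ioi_subset_Ioi hU)
    exact this.congr_fun (fun u _ => by simp) measurableSet_Ioi
  have h := norm_integral_le_of_norm_le hint
    (f := fun u : ℝ => deBruijnPhi u * u * Real.sin (x' * u)) (μ := volume.restrict (Ioi U)) ?_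
  · simpa only [Real.norm_eq_abs] using h
  · rw [ae_restrict_iff' measurableSet_Ioi]
    refine Filter.Eventually.of_forall fun u hu => ?_
    have hu0 : 0 ≤ u := hU.trans (le_of_lt hu)
    have hp : 0 ≤ deBruijnPhi u * u := mul_nonneg (deBruijnPhi_pos_of_nonneg hu0).le hu0
    rw [Real.norm_eq_abs, abs_mul, abs_of_nonneg hp]
    calc deBruijnPhi u * u * |Real.sin (x' * u)| ≤ deBruijnPhi u * u * 1 :=
          mul_le_mul_of_nonneg_left (Real.abs_sin_le_one _) hp
      _ = deBruijnPhi u * u := mul_one _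

/-- **The computable u-weighted tail bound**: `50 e^{10U−πe^{4U}}/(4πe^{4U}−10) · S ≤ uTailD … U` (`U ≥ 0`). [folklore] -/
theorem le_uTailD {S Kexp kexp : ℕ} (hS : 0 < S) {piI : MI} (hpi : MI.mem S Real.pi piI)
    {U : ℚ} (hU : 0 ≤ U) {T : ℤ} (h : uTailD S Kexp kexp piI U = some T) :
    50 * Real.exp (10 * (U : ℝ) - Real.pi * Real.exp (4 * (U : ℝ))) / (4 * Real.pi * Real.exp (4 * (U : ℝ)) - 10) * S
      ≤ T := by
  simp only [uTailD] at h
  split at h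
  · rename_i e4 he4
    split at h
    · rename_i g hg
      simp only [Option.some.injEq] at h
      subst h
      have m4 := MI.mem_exp hS he4 (UniversalFactor.osa_mem_ofFracQ S _)
      have mg := MI.mem_exp hS hg (MI.mem_sub (UniversalFactor.osa_mem_ofFracQ S _) (MI.mem_mul hS hpi m4))
      have h50 := (MI.mem_mulInt mg 50).2
      have hπ : 3 < Real.pi := Real.pi_gt_three
      have he1 : 1 ≤ Real.exp (4 * (U : ℝ)) := Real.one_le_exp (by positivity)
      have hden : 2 ≤ 4 * Real.pi * Real.exp (4 * (U : ℝ)) - 10 := by nlinarith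
      set Ex := Real.exp (10 * (U : ℝ) - Real.pi * Real.exp (4 * (U : ℝ))) with hEx
      have hEx0 : 0 ≤ Ex := (Real.exp_pos _).le
      have hc := Numerics.le_cdiv_mul_real (a := (g.mulInt 50).hi) (b := 2) (by norm_num)
      have h1 : 50 * Ex / (4 * Real.pi * Real.exp (4 * (U : ℝ)) - 10) * S ≤ 50 * Ex / 2 * S := by
        have : 50 * Ex / (4 * Real.pi * Real.exp (4 * (U : ℝ)) - 10) ≤ 50 * Ex / 2 :=
          div_le_div_of_nonneg_left (by positivity) (by norm_num) hden
        exact mul_le_mul_of_nonneg_right this (Nat.cast_nonneg S)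
      refine h1.trans ?_
      have h2 : Ex * 50 * S ≤ ((g.mulInt 50).hi : ℝ) := by
        have := h50; push_cast at this; linarith
      push_cast at hc
      nlinarith
    · simp at h
  · simp at h

/-- **Soundness of the derivative error constants**: for a valid context with `derivErr C = some (eA, eB)`,
`D(ρ,R) (U+R) Σ_c PhiMaj_c ≤ eA/S` and `2ρ U Σ_c T_N(2cρ) + tail′_U ≤ eB/S` (`U = 2 Cu ρ`). [folklore] -/
theorem derivErr_sound {C : UniversalFactor.OsaCtx} (hV : C.Valid) {eA eB : ℤ}
    (h : derivErr C = some (eA, eB)) :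
    UniversalFactor.osaDefectR C.rho C.RU * (2 * C.Cu * C.rho + C.RU) *
        ∑ c ∈ Finset.range C.Cu, UniversalFactor.osaPhiMajR C.Nth ((2 * c + 1) * C.rho) C.RU ≤ eA / C.S ∧
      2 * C.rho * (2 * C.Cu * C.rho) * ∑ c ∈ Finset.range C.Cu, UniversalFactor.osaThetaT C.Nth (2 * c * C.rho) +
        50 * Real.exp (10 * (2 * C.Cu * C.rho) - Real.pi * Real.exp (4 * (2 * C.Cu * C.rho))) /
          (4 * Real.pi * Real.exp (4 * (2 * C.Cu * C.rho)) - 10) ≤ eB / C.S := by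
  have hS := hV.hS
  have hSr : (0:ℝ) < C.S := by exact_mod_cast hS
  simp only [derivErr] at h
  split at h
  · rename_i sm st tu hsums htu
    simp only [Option.some.injEq, Prod.mk.injEq] at h
    obtain ⟨hA, hB⟩ := h
    set ρq : ℚ := (C.rhoUn : ℚ) / C.rhoUd with hρq
    set Rq : ℚ := (C.RUn : ℚ) / C.RUd with hRq
    have hρ : ((ρq : ℚ) : ℝ) = C.rho := by rw [hρq]; unfold UniversalFactor.OsaCtx.rho; push_cast; rfl
    have hR : ((Rq : ℚ) : ℝ) = C.RU := by rw [hRq]; unfold UniversalFactor.OsaCtx.RU; push_cast; rfl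
    have hρ0 : 0 ≤ C.rho := by unfold UniversalFactor.OsaCtx.rho; positivity
    have hRU0 : 0 ≤ C.RU := by unfold UniversalFactor.OsaCtx.RU; positivity
    have hρR' : C.rho < C.RU := by
      unfold UniversalFactor.OsaCtx.rho UniversalFactor.OsaCtx.RU
      rw [div_lt_div_iff₀ (by exact_mod_cast hV.hrhod) (by exact_mod_cast hV.hRd)]; exact_mod_cast hV.hρR
    have hsums' := UniversalFactor.osaErrSums_inv hS hV.hpi ρq Rq C.Nth C.Cu 0 (0, 0) hsums
    have hU0 : (0 : ℚ) ≤ 2 * C.Cu * ρq := by rw [hρq]; positivity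
    have htu' := le_uTailD hS hV.hpi hU0 htu
    have hD0 : 0 ≤ UniversalFactor.osaDefectR C.rho C.RU := UniversalFactor.osaDefectR_nonneg hρ0 hρR'
    have hsm : (∑ c ∈ Finset.range C.Cu, UniversalFactor.osaPhiMajR C.Nth ((2 * c + 1) * C.rho) C.RU) * C.S ≤ sm := by
      have := hsums'.1
      rw [zero_add, ← Finset.range_eq_Ico, hρ, hR] at this
      push_cast at this ⊢
      linarith
    have hst : (∑ c ∈ Finset.range C.Cu, UniversalFactor.osaThetaT C.Nth (2 * c * C.rho)) * C.S ≤ st := by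
      have := hsums'.2
      rw [zero_add, ← Finset.range_eq_Ico, hρ] at this
      push_cast at this ⊢
      linarith
    have hU : (((2 * C.Cu * ρq : ℚ)) : ℝ) = 2 * C.Cu * C.rho := by push_cast; rw [hρ]
    rw [hU] at htu'
    constructor
    · -- errAD bound
      rw [← hA]
      set dA : ℚ := UniversalFactor.osaDefectQ ρq Rq * sm * (2 * C.Cu * ρq + Rq) with hdA
      have hc := Numerics.le_cdiv_mul_real (a := dA.num) (b := dA.den) (by exact_mod_cast Rat.den_pos _)
      push_cast at hc
      have hden : (0 : ℝ) < (dA.den : ℝ) := by exact_mod_cast Rat.den_pos _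
      have hdAR : ((dA : ℚ) : ℝ) = UniversalFactor.osaDefectR C.rho C.RU * sm * (2 * C.Cu * C.rho + C.RU) := by
        rw [hdA]; push_cast; rw [UniversalFactor.osaDefectQ_cast, hρ, hR]
      have hq : ((dA : ℚ) : ℝ) = (dA.num : ℝ) / dA.den := Rat.cast_def dA
      rw [le_div_iff₀ hSr]
      push_cast
      have hUR0 : 0 ≤ 2 * C.Cu * C.rho + C.RU := by positivity
      have h1 : UniversalFactor.osaDefectR C.rho C.RU * (2 * C.Cu * C.rho + C.RU) *
          (∑ c ∈ Finset.range C.Cu, UniversalFactor.osaPhiMajR C.Nth ((2 * c + 1) * C.rho) C.RU) * C.S ≤ ((dA : ℚ) : ℝ) := by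
        rw [hdAR]
        have := mul_le_mul_of_nonneg_left hsm (mul_nonneg hD0 hUR0)
        calc UniversalFactor.osaDefectR C.rho C.RU * (2 * C.Cu * C.rho + C.RU) *
              (∑ c ∈ Finset.range C.Cu, UniversalFactor.osaPhiMajR C.Nth ((2 * c + 1) * C.rho) C.RU) * C.S
            = UniversalFactor.osaDefectR C.rho C.RU * (2 * C.Cu * C.rho + C.RU) *
              ((∑ c ∈ Finset.range C.Cu, UniversalFactor.osaPhiMajR C.Nth ((2 * c + 1) * C.rho) C.RU) * C.S) := by ring
          _ ≤ UniversalFactor.osaDefectR C.rho C.RU * (2 * C.Cu * C.rho + C.RU) * sm := this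
          _ = _ := by ring
      have h2 : ((dA : ℚ) : ℝ) ≤ (Numerics.cdiv dA.num dA.den : ℝ) := by
        rw [hq, div_le_iff₀ hden]; exact hc
      linarith
    · -- errBD bound
      rw [← hB]
      set dB : ℚ := 2 * ρq * (2 * C.Cu * ρq) * st with hdB
      have hc := Numerics.le_cdiv_mul_real (a := dB.num) (b := dB.den) (by exact_mod_cast Rat.den_pos _)
      push_cast at hc
      have hden : (0 : ℝ) < (dB.den : ℝ) := by exact_mod_cast Rat.den_pos _
      have hq : ((dB : ℚ) : ℝ) = (dB.num : ℝ) / dB.den := Rat.cast_def dB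
      have hdBR : ((dB : ℚ) : ℝ) = 2 * C.rho * (2 * C.Cu * C.rho) * st := by rw [hdB]; push_cast; rw [hρ]
      rw [le_div_iff₀ hSr]
      push_cast at hst htu' ⊢
      have h1 : 2 * C.rho * (2 * C.Cu * C.rho) * (∑ c ∈ Finset.range C.Cu, UniversalFactor.osaThetaT C.Nth
          (2 * c * C.rho)) * C.S ≤ ((dB : ℚ) : ℝ) := by
        rw [hdBR, mul_assoc]
        exact mul_le_mul_of_nonneg_left hst (by positivity)
      have h2 : ((dB : ℚ) : ℝ) ≤ (Numerics.cdiv dB.num dB.den : ℝ) := by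
        rw [hq, div_le_iff₀ hden]; exact hc
      nlinarith
  · simp at h

/-! ## The evaluator of `H_0′` is sound -/

/-- **Soundness of the u-side evaluator of `H_0′`**: `Re H_0′(xn/xd) ∈ evalH0D C xn xd` for a valid
context. [folklore] -/
theorem mem_evalH0D {C : UniversalFactor.OsaCtx} (hV : C.Valid) {xn xd : ℕ} (hxd : 0 < xd) {v : MI}
    (h : evalH0D C xn xd = some v) :
    MI.mem C.S (deriv (deBruijnH 0) ((((xn : ℝ) / xd : ℝ)) : ℂ)).re v := by
  simp only [evalH0D] at h
  split at h
  · rename_i B NF E eA eB hB hNF hE hDE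
    split_ifs at h with hcond
    obtain ⟨hEhi, heA0⟩ := hcond
    simp only [Option.some.injEq] at h
    subst h
    -- basic quantities
    set x' : ℝ := (xn : ℝ) / xd with hx'
    have hx0 : 0 ≤ x' := by positivity
    have hS := hV.hS
    have hSr : (0 : ℝ) < C.S := by exact_mod_cast hS
    have hρ0 : 0 < C.rho := by
      have := hV.hrho; have := hV.hrhod; unfold UniversalFactor.OsaCtx.rho; positivity
    have hρR : C.rho < C.RU := by
      unfold UniversalFactor.OsaCtx.rho UniversalFactor.OsaCtx.RU
      rw [div_lt_div_iff₀ (by exact_mod_cast hV.hrhod) (by exact_mod_cast hV.hRd)]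
      exact_mod_cast hV.hρR
    have hR4 : C.RU ≤ 1 / 4 := by
      unfold UniversalFactor.OsaCtx.RU
      rw [div_le_iff₀ (by exact_mod_cast hV.hRd)]
      have := hV.hR4
      have : (4 * C.RUn : ℝ) ≤ C.RUd := by exact_mod_cast this
      linarith
    -- enclosures of the rotation factors and of e^{x'R}
    have hBmem : MC.mem C.S (Complex.exp (((x' * ((2 * ((C.Cu - C.Cu : ℕ) : ℝ) + 1) * C.rho) : ℝ) : ℂ) * Complex.I)) B := by
      have hm : MI.mem C.S (x' * C.rho) (MI.ofFrac C.S ((xn : ℤ) * C.rhoUn) (xd * C.rhoUd)) := by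
        have := MI.mem_ofFrac C.S ((xn : ℤ) * C.rhoUn) (q := xd * C.rhoUd) (by have := hV.hrhod; positivity)
        refine UniversalFactor.osa_mem_congr this ?_
        unfold UniversalFactor.OsaCtx.rho; rw [hx']; push_cast; field_simp
      have := MC.mem_expI hS hV.hpi hB hm
      convert this using 3
      simp
    have hB2 : MC.mem C.S (Complex.exp (((2 * x' * C.rho : ℝ) : ℂ) * Complex.I)) (MC.mul C.S B B) := by
      have hB1 : MC.mem C.S (Complex.exp (((x' * C.rho : ℝ) : ℂ) * Complex.I)) B := by
        convert hBmem using 3; simp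
      have := MC.mem_mul hS hB1 hB1
      convert this using 2
      rw [← Complex.exp_add]; push_cast; ring_nf
    have hNF' := UniversalFactor.osaNodeFactors_inv hV hxd 32 hNF
    have hEmem : MI.mem C.S (Real.exp (x' * C.RU)) E := by
      refine MI.mem_exp hS hE ?_
      have := MI.mem_ofFrac C.S ((xn : ℤ) * C.RUn) (q := xd * C.RUd) (by have := hV.hRd; positivity)
      refine UniversalFactor.osa_mem_congr this ?_
      unfold UniversalFactor.OsaCtx.RU; rw [hx']; push_cast; field_simp
    -- the glsD sums
    have hs := cellsLoopD_inv hV hNF'.2 hB2 C.Cu le_rfl hBmem (MI.mem_ofInt C.S 0)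
    simp only [Nat.sub_self, Int.cast_zero, zero_add] at hs
    -- the analytic error
    set gls : ℝ := ∑ c ∈ Finset.Ico 0 C.Cu, cellGLD C.Nth C.rho x' c with hgls
    set J : ℝ := ∫ u in Ioi (0:ℝ), deBruijnPhi u * u * Real.sin (x' * u) with hJ
    have hderiv : (deriv (deBruijnH 0) ((x' : ℝ) : ℂ)).re = -J := by
      rw [hJ, re_deriv_deBruijnH_zero_ofReal]
    have hdec := H0D_decomp x' hρ0.le C.Cu
    have hcells : ∀ c ∈ Finset.range C.Cu,
        |(∫ u in (2 * c * C.rho)..(2 * (c + 1) * C.rho), deBruijnPhi u * u * Real.sin (x' * u)) - cellGLD C.Nth C.rho x' c| ≤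
          UniversalFactor.osaPhiMajR C.Nth ((2 * c + 1) * C.rho) C.RU * ((2 * C.Cu * C.rho + C.RU) * Real.exp (x' * C.RU) *
              UniversalFactor.osaDefectR C.rho C.RU) +
            2 * C.rho * (2 * C.Cu * C.rho) * UniversalFactor.osaThetaT C.Nth (2 * c * C.rho) :=
      fun c hc => cellD_error hV.hN hρ0.le hρR hR4 hx0 (Finset.mem_range.1 hc)
    have htail := uTailD_error x' (U := 2 * C.Cu * C.rho) (by positivity)
    obtain ⟨herrA, herrB⟩ := derivErr_sound hV hDE
    have herr : |J - gls| ≤ Real.exp (x' * C.RU) * (eA / C.S) + eB / C.S := by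
      have e1 : J - gls = ∑ c ∈ Finset.range C.Cu,
          ((∫ u in (2 * c * C.rho)..(2 * (c + 1) * C.rho), deBruijnPhi u * u * Real.sin (x' * u)) -
            cellGLD C.Nth C.rho x' c) +
          ∫ u in Ioi (2 * C.Cu * C.rho), deBruijnPhi u * u * Real.sin (x' * u) := by
        rw [hJ, hdec, hgls, Finset.range_eq_Ico, Finset.sum_sub_distrib]
        ring
      rw [e1]
      refine (abs_add_le _ _).trans ?_
      refine (add_le_add ((Finset.abs_sum_le_sum_abs _ _).trans (Finset.sum_le_sum hcells)) htail).trans ?_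
      rw [Finset.sum_add_distrib, ← Finset.sum_mul, ← Finset.mul_sum, add_assoc]
      refine add_le_add ?_ herrB
      have hE0 : 0 ≤ Real.exp (x' * C.RU) := (Real.exp_pos _).le
      calc (∑ i ∈ Finset.range C.Cu, UniversalFactor.osaPhiMajR C.Nth ((2 * i + 1) * C.rho) C.RU) *
            ((2 * C.Cu * C.rho + C.RU) * Real.exp (x' * C.RU) * UniversalFactor.osaDefectR C.rho C.RU)
          = Real.exp (x' * C.RU) * (UniversalFactor.osaDefectR C.rho C.RU * (2 * C.Cu * C.rho + C.RU) *
              ∑ i ∈ Finset.range C.Cu, UniversalFactor.osaPhiMajR C.Nth ((2 * i + 1) * C.rho) C.RU) := by ring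
        _ ≤ Real.exp (x' * C.RU) * (eA / C.S) := mul_le_mul_of_nonneg_left herrA hE0
    -- in ulps
    have hulps : |(-J) - (-gls)| * C.S ≤ (Numerics.cdiv (E.hi * eA) C.S + eB : ℤ) := by
      rw [show (-J) - (-gls) = -(J - gls) by ring, abs_neg]
      have h1 : |J - gls| * C.S ≤ Real.exp (x' * C.RU) * eA + eB := by
        have := mul_le_mul_of_nonneg_right herr hSr.le
        rw [add_mul, mul_assoc, div_mul_cancel₀ _ hSr.ne', div_mul_cancel₀ _ hSr.ne'] at this
        exact this
      have h2 : Real.exp (x' * C.RU) ≤ (E.hi : ℝ) / C.S := MI.le_hi_div hS hEmem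
      have hA0 : (0 : ℝ) ≤ eA := by exact_mod_cast heA0
      have h3 : Real.exp (x' * C.RU) * eA ≤ (E.hi : ℝ) / C.S * eA := mul_le_mul_of_nonneg_right h2 hA0
      have h4 := Numerics.le_cdiv_mul_real (a := E.hi * eA) (b := C.S) (by exact_mod_cast hS)
      have h5 : (E.hi : ℝ) / C.S * eA ≤ (Numerics.cdiv (E.hi * eA) C.S : ℝ) := by
        rw [div_mul_eq_mul_div, div_le_iff₀ hSr]; push_cast at h4 ⊢; exact h4
      push_cast
      linarith
    have hneg := MI.mem_neg hs
    have := MI.mem_widen hneg (x' := -J) hulps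
    rw [← hderiv, hx'] at this
    exact this
  · simp at h

end Summit.RiemannHypothesis.RiemannHypothesis.Theorems.Splittings.LinearRayOnePoint

end
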